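import Summits.BirchSwinnertonDyer.BirchSwinnertonDyer.Theorems.PrintCFramMordellNoNineTorsionZetaNine
import Summits.BirchSwinnertonDyer.Rank1Residual.X12.O11.AnticyclotomicLocalTorsionThree
import Literature.AnabelianGeometry.EtaleTheta.RootsOfUnityGaloisPrimePower
import HarnessLib

/-!
# No `K_𝔭`-point of order `9` at a `3`-frame: `W_K(K_𝔭)[3^∞] = W_K(K_𝔭)[3] ⊆ W[3]` (`K_𝔭 = ℚ₃(√−3)`)
# (cell `bsd-print-cfram`, seat p3 g3; regime T item `PrintCFram.LocalThreeTorsionBSDThree` = stmt-BirchSwinnertonDyer-20699)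

HONEST FRAMING (cell `bsd-print-cfram`, run/shared/lean/pub/bsd-print-cfram/, D-0131 (2) print tier): nothing is closed
here; theorems only (no definition, no named fact, no `sorry`). Companion of `PrintCFramMordellNoNineTorsionZetaNine.lean`
(§1–§3: `y² = x³ + k` has no point of order `9` over a field `F ∋ √−3` without a primitive ninth root of unity). Here:

* §4 `pow_three_eq_one_of_pow_nine_eq_one` — no primitive ninth root of unity in a field of degree `≤ 2` over a copy of
  `ℚ₃` (`Φ₉` is irreducible of degree `φ(9) = 6` over `ℚ₃`: tree `irreducible_cyclotomic_prime_pow_padic`, Serre,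
  *Local Fields* IV §4 Prop. 17);
* §5 **`three_smul_eq_zero_of_pow_smul_adicCompletion_of_isFrameThree`** — at a `3`-frame `IsFrameThree W K 𝔭 W' C`
  with `W` a `ℚ`-model of `y² = x³ + k` (`C₀ • W = E_k`, `k ≠ 0` — every `j = 0` curve): every point of `W_K(K_𝔭)`
  killed by a power of `3` is killed by `3` (§3 over `L = K_𝔭` with `θ = √−3 ∈ K ⊂ K_𝔭`, `[K_𝔭 : ℚ₃] ≤ 2`); the `9`-form;
  `primaryComponent_adicCompletion_eq_torsionBy_three_of_isFrameThree`: `W_K(K_𝔭)[3^∞] = W_K(K_𝔭)[3]`.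
  So ty3 PART H's `dP = #W_K(K_𝔭)[3^∞]` (= `#W(ℚ₃)[3^∞]·#W'(ℚ₃)[3^∞]`, p3 p560593; displayed by ty2's T package
  p559111) is the order of a subgroup of `W[3]`, class-wide, no per-class certificate — the local counterpart of p4's
  global `d₀` theorems (`PrintCFramTCubeNoNineTorsion`, `…GlobalDefectCard`).

Not here: the layers `K^ac_{n,𝔭}` of the local anticyclotomic tower (needs «`ζ₉ ∉ K^ac_{n,𝔭}`», dihedral; then §3
applies verbatim — p3 census LEMMA 1/2, HOME/p3/T-TORSION-GROWTH.md). beyond-print: NO.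
References: [SerreLocalFields1979] IV §4 Prop. 17; [SilvermanAEC2009] Exercise 3.7, III.10.
-/

set_option linter.dupNamespace false
set_option autoImplicit false

noncomputable section

open scoped Classical
open WeierstrassCurve Polynomial NumberField IsDedekindDomain
  Literature.NumberTheory.EllipticCurves
  Literature.NumberTheory.EllipticCurves.Rank1Residual
  Literature.NumberTheory.GaloisRepresentations
  Summit.BirchSwinnertonDyer.Rank1Residual Summit.BirchSwinnertonDyer.Rank1Residual.X12
  Summit.BirchSwinnertonDyer.Rank1Residual.X11b Summit.BirchSwinnertonDyer.Rank1Residual.X12.O11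
  Summit.BirchSwinnertonDyer.BirchSwinnertonDyer.Theorems.PrintCFram.GlobalDefect

namespace Summit.BirchSwinnertonDyer.BirchSwinnertonDyer.Theorems.PrintCFram.NoZetaNine

/-! ## §4 No primitive ninth root of unity in a field of degree `≤ 2` over `ℚ₃` -/

/-- **`ζ₉ ∉ L` when `[L : ℚ₃] ≤ 2`** (in particular in `K_𝔭 = ℚ₃(√−3)`): `Φ₉` is irreducible of degree
`φ(9) = 6` over `ℚ₃` (Serre, *Local Fields* IV §4 Prop. 17; tree `irreducible_cyclotomic_prime_pow_padic`),
so a primitive ninth root of unity has degree `6 > 2` over `ℚ₃`. Here `F₀ ≃ ℚ₃` is any copy (the tree's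
`(ratPlace 3).adicCompletion ℚ`). [cite: SerreLocalFields1979, IV §4 Prop 17] -/
theorem pow_three_eq_one_of_pow_nine_eq_one {F₀ L : Type*} [Field F₀] [Field L] [Algebra F₀ L]
    [FiniteDimensional F₀ L] (e : F₀ ≃+* ℚ_[3]) (hdeg : Module.finrank F₀ L ≤ 2)
    (z : L) (h9 : z ^ 9 = 1) : z ^ 3 = 1 := by
  haveI : Fact (Nat.Prime 3) := ⟨Nat.prime_three⟩
  haveI : CharZero F₀ := e.toRingHom.charZero
  haveI : CharZero L := charZero_of_injective_algebraMap (algebraMap F₀ L).injective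
  by_contra h3
  -- `z` is a primitive ninth root of unity
  have hord : orderOf z = 9 := by
    have hdvd : orderOf z ∣ 3 ^ 2 := orderOf_dvd_of_pow_eq_one (by simpa using h9)
    obtain ⟨i, hi, hi'⟩ := (Nat.dvd_prime_pow Nat.prime_three).mp hdvd
    interval_cases i
    · exfalso; apply h3
      rw [pow_zero, orderOf_eq_one_iff] at hi'
      rw [hi', one_pow]
    · exfalso; apply h3
      rw [pow_one] at hi'
      rw [← hi']; exact pow_orderOf_eq_one z
    · simpa using hi'
  have hprim : IsPrimitiveRoot z 9 := by rw [← hord]; exact IsPrimitiveRoot.orderOf z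
  -- `Φ₉(z) = 0`, so `minpoly_{F₀} z = Φ₉` of degree `6`
  have hroot : Polynomial.aeval z (Polynomial.cyclotomic 9 F₀) = 0 := by
    have h := (Polynomial.isRoot_cyclotomic_iff (n := 9) (R := L)).mpr hprim
    rw [Polynomial.aeval_def, ← Polynomial.eval_map, Polynomial.map_cyclotomic]
    exact h
  have hirrQ : Irreducible (Polynomial.cyclotomic 9 ℚ_[3]) :=
    Literature.AnabelianGeometry.EtaleTheta.irreducible_cyclotomic_prime_pow_padic 3 (k := 2) two_pos
  have hirr : Irreducible (Polynomial.cyclotomic 9 F₀) := by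
    have h := (MulEquiv.irreducible_iff (Polynomial.mapEquiv e.symm).toMulEquiv).mpr hirrQ
    have hmap : (Polynomial.mapEquiv e.symm).toMulEquiv (Polynomial.cyclotomic 9 ℚ_[3]) =
        Polynomial.cyclotomic 9 F₀ := by
      change (Polynomial.cyclotomic 9 ℚ_[3]).map (e.symm : ℚ_[3] →+* F₀) = _
      rw [Polynomial.map_cyclotomic]
    rwa [hmap] at h
  have hmin : Polynomial.cyclotomic 9 F₀ = minpoly F₀ z :=
    minpoly.eq_of_irreducible_of_monic hirr hroot (Polynomial.cyclotomic.monic 9 F₀)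
  have hdeg6 : (minpoly F₀ z).natDegree = 6 := by
    rw [← hmin, Polynomial.natDegree_cyclotomic]; decide
  have hle := minpoly.natDegree_le (A := F₀) z
  omega

/-! ## §5 At a `3`-frame: no `K_𝔭`-point of order `9`, hence `#W_K(K_𝔭)[3^∞] = #W_K(K_𝔭)[3]` -/

section Frame

variable (W : WeierstrassCurve ℚ) [W.IsElliptic] [W.IsGloballyMinimal]
  {K : Type} [Field K] [NumberField K] {𝔭 : IsDedekindDomain.HeightOneSpectrum (NumberField.RingOfIntegers K)}
  {W' : WeierstrassCurve ℚ} [W'.IsElliptic] [W'.IsGloballyMinimal] {C : VariableChange ℚ}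

omit [W.IsGloballyMinimal] [W'.IsElliptic] [W'.IsGloballyMinimal] in
/-- **No `K_𝔭`-point of order `9` at a `3`-frame — the `3`-primary torsion of `W_K(K_𝔭)` is killed by `3`**
(`K_𝔭 = ℚ₃(√−3)`): for `W` any `ℚ`-model of a Mordell curve `y² = x³ + k` (`C₀ • W = E_k`, `k ≠ 0` — every
`j = 0` curve), every point of `W_K(K_𝔭)` killed by a power of `3` is killed by `3`. (§3 over `L = K_𝔭` with
`θ = √−3 ∈ K ⊂ K_𝔭`, and §4: `[K_𝔭 : ℚ₃] ≤ 2` so `ζ₉ ∉ K_𝔭`.) So the local defect of record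
`dP = #W_K(K_𝔭)[3^∞]` (ty3 PART H; ty2's T package; p3's `finite_primaryComponent_adicCompletion_three_of_isFrameThree`)
is the order of a subgroup of `W[3]`, class-wide, with no per-class certificate. [cite: SilvermanAEC2009, Exercise 3.7 and III.10]
[cite: SerreLocalFields1979, IV §4 Prop 17] -/
theorem three_smul_eq_zero_of_pow_smul_adicCompletion_of_isFrameThree
    (hF : Summit.BirchSwinnertonDyer.Rank1Residual.X12.O11.IsFrameThree W K 𝔭 W' C)
    {C₀ : VariableChange ℚ} {k : ℚ} (hk : k ≠ 0) (hW : C₀ • W = mordellCurve k)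
    (Q : ((W.baseChange K).baseChange (𝔭.adicCompletion K)).toAffine.Point) {n : ℕ}
    (hn : (3 : ℕ) ^ n • Q = 0) : (3 : ℕ) • Q = 0 := by
  have hp : Nat.Prime 3 := Nat.prime_three
  haveI : Fact (Nat.Prime 3) := ⟨hp⟩
  have hK2 : Module.finrank ℚ K = 2 := hF.2.2.1.1
  have h3𝔭 : ((3 : ℕ) : NumberField.RingOfIntegers K) ∈ 𝔭.asIdeal := hF.2.2.2.2.1
  -- the local fields `F₀ = ℚ_v(3) ≃ ℚ₃` and `L = K_𝔭`, `[L : F₀] ≤ 2`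
  haveI : 𝔭.asIdeal.LiesOver (ratPlace 3).asIdeal := ⟨by rw [← under_eq_ratPlace_of_mem h3𝔭]; rfl⟩
  set F₀ : Type := (ratPlace 3).adicCompletion ℚ with hF₀def
  set L : Type := 𝔭.adicCompletion K with hLdef
  haveI : CharZero L := charZero_of_injective_algebraMap (algebraMap K L).injective
  letI : Algebra F₀ L := (adicCompletionMap (K := ℚ) K (ratPlace 3) 𝔭).toAlgebra
  obtain ⟨hfin, hle⟩ := finrank_adicCompletion_le_of_liesOver (K := ℚ) K (ratPlace 3) 𝔭
  haveI : FiniteDimensional F₀ L := hfin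
  rw [hK2] at hle
  let e : F₀ ≃+* ℚ_[3] := (Padic.adicCompletionEquiv (𝓞 ℚ) ⟨3, hp⟩).symm.toAlgEquiv.toRingEquiv
  have hζ : ∀ z : L, z ^ 9 = 1 → z ^ 3 = 1 := pow_three_eq_one_of_pow_nine_eq_one e hle
  -- `θ = √−3 ∈ L`
  obtain ⟨θ₁, -, hθ₁sq⟩ := exists_sq_eq_discr_not_mem_range K hK2
  have hθK : θ₁ ^ 2 = -3 := by rw [hθ₁sq, hF.discr_eq]; simp
  have hθ : (algebraMap K L θ₁) ^ 2 = -3 := by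
    rw [← map_pow, hθK, map_neg, map_ofNat]
  -- transport `W_K ⊗ L ≅ E_k ⊗ L`
  have hKL : (W.baseChange K).baseChange L = W.baseChange L := W.map_baseChange (algebraMap K L).toRatAlgHom
  have hmodel : (mordellCurve k).baseChange L = (C₀.map (algebraMap ℚ L)) • W.baseChange L := by
    rw [← hW, baseChange, baseChange, map_variableChange]
  have hmk : (mordellCurve k).baseChange L = mordellCurve (k : L) := by
    rw [mordellCurve_baseChange]; rfl
  have hkL : (k : L) ≠ 0 := by exact_mod_cast hk
  let ε : ((W.baseChange K).baseChange L).toAffine.Point ≃+ (mordellCurve (k : L)).toAffine.Point :=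
    (Affine.Point.congrEquiv hKL).trans
      ((VariableChange.pointEquiv (W.baseChange L) (C₀.map (algebraMap ℚ L))).trans
        (Affine.Point.congrEquiv (hmodel.symm.trans hmk)))
  have hne : (3 : ℕ) ^ n • ε Q = 0 := by rw [← map_nsmul, hn, map_zero]
  have h3e := three_smul_eq_zero_of_pow_smul_eq_zero hθ hζ hkL (ε Q) hne
  rw [← map_nsmul] at h3e
  exact (map_eq_zero_iff ε ε.injective).mp h3e

omit [W.IsGloballyMinimal] [W'.IsElliptic] [W'.IsGloballyMinimal] in
/-- The `9`-torsion form: at a `3`-frame, every point of `W_K(K_𝔭)` killed by `9` is killed by `3`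
(`W` a model of `y² = x³ + k`, `k ≠ 0`). [cite: SilvermanAEC2009, Exercise 3.7 and III.10] -/
theorem three_smul_eq_zero_of_nine_smul_adicCompletion_of_isFrameThree
    (hF : Summit.BirchSwinnertonDyer.Rank1Residual.X12.O11.IsFrameThree W K 𝔭 W' C)
    {C₀ : VariableChange ℚ} {k : ℚ} (hk : k ≠ 0) (hW : C₀ • W = mordellCurve k)
    (Q : ((W.baseChange K).baseChange (𝔭.adicCompletion K)).toAffine.Point) (h9 : (9 : ℕ) • Q = 0) :
    (3 : ℕ) • Q = 0 :=
  three_smul_eq_zero_of_pow_smul_adicCompletion_of_isFrameThree W hF hk hW Q (n := 2) (by simpa using h9)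

omit [W.IsGloballyMinimal] [W'.IsElliptic] [W'.IsGloballyMinimal] in
/-- **`W_K(K_𝔭)[3^∞] = W_K(K_𝔭)[3]` at a `3`-frame** (as subgroups of the `K_𝔭`-points): the
`3`-primary component is the `3`-torsion. Hence `dP = #W_K(K_𝔭)[3^∞] = #W_K(K_𝔭)[3]` divides `9`
(a subgroup of `W[3] ≅ (ℤ/3)²`). [cite: SilvermanAEC2009, Exercise 3.7 and III.10] -/
theorem primaryComponent_adicCompletion_eq_torsionBy_three_of_isFrameThree
    (hF : Summit.BirchSwinnertonDyer.Rank1Residual.X12.O11.IsFrameThree W K 𝔭 W' C)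
    {C₀ : VariableChange ℚ} {k : ℚ} (hk : k ≠ 0) (hW : C₀ • W = mordellCurve k) :
    (AddCommGroup.primaryComponent ((W.baseChange K).baseChange (𝔭.adicCompletion K)).toAffine.Point 3
        : Set ((W.baseChange K).baseChange (𝔭.adicCompletion K)).toAffine.Point) =
      {Q | (3 : ℕ) • Q = 0} := by
  haveI : Fact (Nat.Prime 3) := ⟨Nat.prime_three⟩
  ext Q
  simp only [SetLike.mem_coe, Set.mem_setOf_eq]
  constructor
  · intro hQ
    obtain ⟨n, hn⟩ := (AddCommGroup.mem_primaryComponent).mp hQ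
    exact three_smul_eq_zero_of_pow_smul_adicCompletion_of_isFrameThree W hF hk hW Q hn
  · intro hQ
    exact (AddCommGroup.mem_primaryComponent).mpr ⟨1, by simpa using hQ⟩

end Frame

end Summit.BirchSwinnertonDyer.BirchSwinnertonDyer.Theorems.PrintCFram.NoZetaNine

end
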